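import Literature.MathematicalPhysics.QuantumFieldTheory.Balaban1983to89.B9Eq389CubeLocalisedProjectionProfile

/-!
# `Balaban1983to89.B9Eq389CubeLocalisedProjectionAdjoint` — T. Bałaban, *Propagators for lattice gauge theories in a background field*, Commun. Math. Phys. **99**
# (1985) 389–434 [Balaban1985BackgroundPropagators] Cor 3.6 p. 408 with (3.87)–(3.89) p. 409, (3.8) p. 392, (3.26) p. 395: **S-P6′(β) AT THE LATTICE IN THE SHAPE
# S-P6′(γ) CONSUMES — at `w = D_U†z` for a BOND field `z` supported over a set of blocks `Z₀`.  The divergence `D_U† = D_U*` ((3.8); `adjoint_covDerivL2K`) reads a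
# bond field at `(y, μ)` and `(y − e_μ, μ)` only, so `D_U†z` is supported over the blocks within coarse distance `1` of `Z₀` (§1); hence this lineage's
# `B9Eq389CubeLocalisedProjectionProfile.norm_sub_projR_collar_le` gives, for the collar cube around that `1`-neighbourhood,
# `‖D_U†z − R″(D_U†z)‖ ≤ ‖D_U†z − R′(D_U†z)‖ + ε·‖D_U†z‖` with `R′ = projR Δ^η_U Q̃′(U)` (= `R(U)`) and
# `ε = C·K_d(κ∕2)·e^{−(κ∕2)r₀} + a₁c_P + (a₀ + C_Ψb₀)c_P²` — LITERALLY the `hcmp` binder of ne9-leaf-06's abstract (γ)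
# `B9Eq387CubeLocalisedProjection.cube_form_ge` (§2)** — route R2′ STEP B7′∕B8′, S-P6′(β)→(γ), instance-ledger row L10 (loc) of the pub-balaban NE9 chain

statement-level skeleton of published theorems with citation tags; proofs where landed; nothing here is a claim about the Yang–Mills mass gap

CITATION HEADER (lean-in-tree rule).  Audit cell `pub-balaban`, sub-cell `t4`, BINDER row NE9; filed by NE9 formalisation-swarm LEAF PROVER 05
(`b2b-balaban-t4-ne9-formalise-leaf-05`, gen 77) as the COMPOSITION BY NAME of this lineage's `B9Eq389CubeLocalisedProjectionProfile.norm_sub_projR_collar_le` with the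
support bookkeeping of the divergence (3.8) (`B9Eq33CovDerivVector.covDiv_apply`, the cell's `B11Eq103H1Complex.adjoint_covDerivL2K`, ne9-leaf-01 g85's
`B9Eq349LaplacePrimeBlockLetters.tdist_blockCoord_unshift_le_one`) and ne9-leaf-06's `B9Eq387CubeLocalisedProjectionLattice.projR_QprimeL2_eq_RofU` (`R′ = R(U)`).
CONSUMER BY SHAPE: `B9Eq387CubeLocalisedProjection.cube_form_ge` ∕ `cube_form_ge'` (their `hcmp`).  Source READ in the held text [Balaban1985BackgroundPropagators]:
p. 392 (3.8) (the adjoint derivative), p. 395 (3.26) (`D R D*` — the non-local letter of `Δ_a`), p. 408 Cor 3.6, p. 409 (3.87)–(3.89).  NOTHING of print's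
estimates is asserted.

WHAT IS PROVED (sorry-free; proof lane — no `def`; [folklore] support bookkeeping + composition BY NAME).
* §1 **`covDivL2K_apply_eq_zero_of_far`** — for a bond field `A` vanishing on every bond whose base block is outside `Z₀` and a fine site `y` whose block is at
  coarse distance `> 1` from `Z₀`: `(D*A)(y) = 0` (ANY scaling `c`, ANY transporters `S`); **`adjoint_covDerivL2K_apply_eq_zero_of_far`** — the same for
  `D_U† = LinearMap.adjoint D_U` under `hRS`.
* §2 **`norm_sub_projR_collar_le_adjoint`** — S-P6′(β) for `w = D_U†z`, `z` supported over `Z₀`, support set `Y₀ := {y : ∃ z₀ ∈ Z₀, d_m(z₀, y) ≤ 1}` (a letter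
  with defining equation), collar cube `{y : ∃ y₀ ∈ Y₀, d_m(y₀, y) < r₀ + R}`: the conclusion of `norm_sub_projR_collar_le` with BOTH projections spelled
  `projR Δs ·` (`Q̃′(U)` and `Q̃′(U) × N.mkQ`) — the `hcmp` shape of (γ).
HONEST SCOPE.  Bookkeeping + one composition; the block decay `(C, κ)`, the scalar windows and the (γ) STRONG-currency coercivity input `hform` are NOT here
(`hform` is the B7′ tower files' — OWNER t4-ne9-p1 ∕ ne9-leaf-06); diagonal `Lη = 1`; ONE averaging step.  NOT NE9 (cell pub-balaban: NE9 NOT PRINTED ∕ NOT PROVED;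
«NE9 ⇐ the named binders»; row WALLED ON A MODEL (O-NE9-1; #5 UNRULED); spine PROVED 0∕9; rung (B)+1 on a finite T⁴ — NOT infinite volume, NOT mass gap, NOT Clay;
HONEST DEPENDENCY: continuum YM on T⁴ ⇐ BetaPertH ∧ nine spine estimates (0/9 proved); BetaPertH ⇐ (D1) ∧ (D4) ∧ CAP+tail; G-an2-4 gates asym, D1 and NE2/3/4).
NEW file; nothing modified.  Net new unproved facts: 0.
-/

noncomputable section

set_option autoImplicit false

open scoped InnerProductSpace ComplexConjugate BigOperators

namespace Literature.MathematicalPhysics.QuantumFieldTheory.Balaban1983to89.B9Eq389CubeLocalisedProjectionAdjoint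

open B4Sect5Torus (TSite tdist tdist_self tdist_symm tdist_triangle)
open B4Sect5Proof (latticeConst)
open B9SectCLatticeCarrier (Bond bpos unshift)
open B9Eq311L2Pairing (WL2)
open B9Eq319QprimeTorus (fineP blockCoord)
open B9Eq33CovDerivVector (covDiv_apply)
open B11Eq103H1Complex (SiteL2K BondL2K covDerivL2K covDivL2K covLaplaceSiteK projR equiv_covDivL2K adjoint_covDerivL2K)
open B7Prop1Explicit (U1)
open B9Eq310HessianOperator (adTransportW)
open B9Eq326OperatorAssembly (QprimeW RofU)
open B9Eq349LaplacePrimeBlockLetters (tdist_blockCoord_unshift_le_one)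
open B9Eq387CubeLocalisedProjectionLattice (projR_QprimeL2_eq_RofU)
open B9Eq389CubeLocalisedProjectionProfile (norm_sub_projR_collar_le)

/-! ## §1 The divergence reads a bond field one lattice step back: support bookkeeping -/

section Support

variable {𝕜 : Type*} [RCLike 𝕜] {d : ℕ} (L : ℕ) [NeZero L] (m : Fin d → ℕ) {W : Type*} [NormedAddCommGroup W] [InnerProductSpace 𝕜 W]
  {c₀ : ℝ} [Fact (0 < c₀)]

/-- **`(D*A)(y) = 0` TWO BLOCKS AWAY FROM THE SUPPORT OF `A`** ((3.8): `(D*A)(y) = c·Σ_μ (S(y−e_μ,μ)A(y−e_μ,μ) − A(y,μ))` reads `A` on bonds based at `y` and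
`y − e_μ`, whose blocks are within coarse distance `1` of the block of `y` — ne9-leaf-01's `tdist_blockCoord_unshift_le_one`): if `A(b) = 0` whenever `blk(b₋) ∉ Z₀`
and `d_m(z₀, blk y) > 1` for every `z₀ ∈ Z₀`, then `(D*A)(y) = 0`, for ANY scaling `c` and ANY transporters `S`. [folklore]
[cite: Balaban1985BackgroundPropagators, (3.8) p.392, (3.49) p.399] -/
theorem covDivL2K_apply_eq_zero_of_far (hm : ∀ i, 1 ≤ m i) (c : 𝕜) (S : Bond d (fineP L m) → W →ₗ[𝕜] W) (A : BondL2K 𝕜 d (fineP L m) c₀ W)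
    (Z₀ : Finset (TSite d m)) (hA : ∀ b : Bond d (fineP L m), blockCoord L m (bpos b) ∉ Z₀ → WL2.equiv 𝕜 _ W A b = 0)
    (y : TSite d (fineP L m)) (hfar : ∀ z₀ ∈ Z₀, 1 < tdist m z₀ (blockCoord L m y)) :
    WL2.equiv 𝕜 _ W (covDivL2K 𝕜 c₀ c S A) y = 0 := by
  rw [equiv_covDivL2K, covDiv_apply]
  have hy : blockCoord L m y ∉ Z₀ := fun hy => by
    have h := hfar _ hy
    rw [tdist_self] at h
    exact absurd h (by norm_num)
  have hterm : ∀ μ : Fin d, S (unshift μ y, μ) (WL2.equiv 𝕜 _ W A (unshift μ y, μ)) - WL2.equiv 𝕜 _ W A (y, μ) = 0 := fun μ => by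
    have h1 : blockCoord L m (unshift μ y) ∉ Z₀ := fun hin => by
      have h := hfar _ hin
      have h2 := tdist_blockCoord_unshift_le_one (L := L) hm y μ
      linarith
    rw [hA (unshift μ y, μ) h1, hA (y, μ) hy, map_zero, sub_zero]
  rw [Finset.sum_eq_zero fun μ _ => hterm μ, smul_zero]

/-- **`(D_U†z)(y) = 0` TWO BLOCKS AWAY FROM THE SUPPORT OF `z`** — `D_U† = LinearMap.adjoint D_U = D_U*` for mutually adjoint transports at the real scaling `η⁻¹`
(`B11Eq103H1Complex.adjoint_covDerivL2K`), then `covDivL2K_apply_eq_zero_of_far`. [folklore] [cite: Balaban1985BackgroundPropagators, (3.8) p.392, (3.23) p.394] -/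
theorem adjoint_covDerivL2K_apply_eq_zero_of_far [FiniteDimensional 𝕜 W] (hm : ∀ i, 1 ≤ m i) (η : ℝ) (R S : Bond d (fineP L m) → W →ₗ[𝕜] W)
    (hRS : ∀ (b : Bond d (fineP L m)) (v u : W), ⟪R b v, u⟫_𝕜 = ⟪v, S b u⟫_𝕜) (z : BondL2K 𝕜 d (fineP L m) c₀ W)
    (Z₀ : Finset (TSite d m)) (hz : ∀ b : Bond d (fineP L m), blockCoord L m (bpos b) ∉ Z₀ → WL2.equiv 𝕜 _ W z b = 0)
    (y : TSite d (fineP L m)) (hfar : ∀ z₀ ∈ Z₀, 1 < tdist m z₀ (blockCoord L m y)) :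
    WL2.equiv 𝕜 _ W (LinearMap.adjoint (covDerivL2K 𝕜 c₀ ((η : 𝕜))⁻¹ R) z) y = 0 := by
  have hc : conj (((η : 𝕜))⁻¹) = ((η : 𝕜))⁻¹ := by rw [map_inv₀, RCLike.conj_ofReal]
  rw [adjoint_covDerivL2K ((η : 𝕜))⁻¹ hc R S hRS]
  exact covDivL2K_apply_eq_zero_of_far L m hm _ S z Z₀ hz y hfar

end Support

/-! ## §2 (β) at `w = D_U†z`: the `hcmp` binder of S-P6′(γ) -/

section Gamma

variable {d : ℕ} (L : ℕ) [NeZero L] (m : Fin d → ℕ) [∀ i, NeZero (fineP L m i)] {𝔸 : Type*} [NormedRing 𝔸] [NormedAlgebra ℂ 𝔸] [NormOneClass 𝔸]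
  {W : Type*} [NormedAddCommGroup W] [InnerProductSpace ℂ W] [FiniteDimensional ℂ W] (φ : W ≃ₗ[ℂ] 𝔸)
  {c₀ : ℝ} [Fact (0 < c₀)] {c₁ : ℝ} [Fact (0 < c₁)] (η : ℝ) (U : Bond d (fineP L m) → 𝔸ˣ)
  (hL : 3 ≤ L) (hLη : (L : ℝ) * η = 1) (hc : c₀ * (L : ℝ) ^ d = c₁)
  {PS : TSite d m → SiteL2K ℂ d (fineP L m) c₀ W →L[ℂ] SiteL2K ℂ d (fineP L m) c₀ W}
  (hPS : ∀ (y : TSite d m) (f : SiteL2K ℂ d (fineP L m) c₀ W) (x : TSite d (fineP L m)),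
    WL2.equiv ℂ (fun _ : TSite d (fineP L m) => c₀) W (PS y f) x =
      if blockCoord L m x = y then WL2.equiv ℂ (fun _ : TSite d (fineP L m) => c₀) W f x else 0)
  {C κ : ℝ} (hC : 0 ≤ C) (hκ : 0 < κ)
  (hdec : ∀ y₀ y₁ : TSite d m, ‖PS y₁ ∘L LinearMap.toContinuousLinearMap (LinearMap.id - RofU L m φ η U (c₀ := c₀)) ∘L PS y₀‖ ≤
    C * Real.exp (-(κ * tdist m y₀ y₁)))
  (hRS : ∀ (b : Bond d (fineP L m)) (v u : W), ⟪adTransportW φ U b v, u⟫_ℂ = ⟪v, adTransportW φ (fun b => (U b)⁻¹) b u⟫_ℂ)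
  {Mφ Mφ' : ℝ} (hMφ : 0 ≤ Mφ) (hφ : ∀ w, ‖φ w‖ ≤ Mφ * ‖w‖) (hMφ' : 0 ≤ Mφ') (hφ' : ∀ X, ‖φ.symm X‖ ≤ Mφ' * ‖X‖)
  (hU1 : ∀ b, U b ∈ U1 𝔸) {ε β₂ : ℝ} (hε : 0 ≤ ε) (hUε : ∀ b, ‖(U b : 𝔸) - 1‖ ≤ ε) (hβ : 0 ≤ β₂)
  (hcol : ∀ (y : TSite d (fineP L m)) (μ : Fin d), ‖(U (y, μ) : 𝔸) - U (unshift μ y, μ)‖ ≤ β₂)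
  (hq : 3 ^ d * ((1 + 2 * Mφ * Mφ' * ε) ^ (d * (L - 1)) - 1) < 1)
  {a' : ℝ} (ha' : 0 < a') {γ : ℝ} (hγ : 0 < γ)
  (hγc : γ ≤ 1 / (2 + 2 / a') -
      (Real.sqrt d * (‖((η : ℂ))⁻¹‖ * (2 * Mφ * Mφ' * ε)) + (Real.sqrt d * (‖((η : ℂ))⁻¹‖ * (2 * Mφ * Mφ' * ε))) ^ 2 +
        a' * (((1 + 2 * Mφ * Mφ' * ε) ^ (d * (L - 1)) - 1)) * (2 + ((1 + 2 * Mφ * Mφ' * ε) ^ (d * (L - 1)) - 1))))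
  (D : SiteL2K ℂ d (fineP L m) c₀ W →ₗ[ℂ] BondL2K ℂ d (fineP L m) c₀ W) (hD : D = covDerivL2K ℂ c₀ ((η : ℂ))⁻¹ (adTransportW φ U))
  (Δs : SiteL2K ℂ d (fineP L m) c₀ W →ₗ[ℂ] SiteL2K ℂ d (fineP L m) c₀ W)
  (hΔs : Δs = covLaplaceSiteK ((η : ℂ))⁻¹ (adTransportW φ U) (adTransportW φ fun b => (U b)⁻¹))
  (Q' : SiteL2K ℂ d (fineP L m) c₀ W →ₗ[ℂ] SiteL2K ℂ d m c₁ W)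
  (hQ' : Q' = (WL2.linearEquiv ℂ ℂ (fun _ : TSite d m => c₁)).symm.toLinearMap ∘ₗ QprimeW L m φ U (c₀ := c₀))
  {cP a₁ a₀ b₀ CΨ : ℝ} (hcP : cP = (Real.sqrt γ)⁻¹)
  (hCΨ : CΨ = (1 - 3 ^ d * ((1 + 2 * Mφ * Mφ' * ε) ^ (d * (L - 1)) - 1))⁻¹ *
    (d * (3 / 2 : ℝ) ^ d * (9 * Real.pi ^ 2) * 2 ^ (d - 1) + d * 3 ^ d * ((L : ℝ) ^ 2 * (Mφ' * Mφ * (2 * β₂ + 4 * ε ^ 2))) +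
      d * (3 / 2 : ℝ) ^ d * (6 * Real.pi) * 2 ^ (d - 1) * ((L : ℝ) * (2 * Mφ * Mφ' * ε))))

include hL hLη hc hPS hC hκ hdec hRS hMφ hφ hMφ' hφ' hU1 hε hUε hβ hcol hq ha' hγ hγc hD hΔs hQ' hcP hCΨ in
/-- **S-P6′(β) AT `w = D_U†z` — THE `hcmp` BINDER OF (γ)** (Cor 3.6 with (3.87)–(3.89); (3.8), (3.26)): under the letters of
`B9Eq389CubeLocalisedProjectionProfile.norm_sub_projR_collar_le` (structure, unit window, scalar windows, the (K1) family with the block decay `(C, κ)` of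
`1 − R(U)`, the constants `c_P, a₁, a₀, b₀, C_Ψ` by defining equations) and the letter `D = D_U`: for a BOND field `z` vanishing on every bond whose base block is
outside `Z₀`, the support set `Y₀ = {y : ∃ z₀ ∈ Z₀, d_m(z₀, y) ≤ 1}` (letter `hY₀`), `0 < r₀`, `0 < R`, and `N` the submodule of the collar cube
`{y : ∃ y₀ ∈ Y₀, d_m(y₀, y) < r₀ + R}` (letter `hN`):
`‖D†z − projR Δs (Q′ × N.mkQ) (D†z)‖ ≤ ‖D†z − projR Δs Q′ (D†z)‖ + (C·K_d(κ∕2)·e^{−(κ∕2)r₀} + a₁c_P + (a₀ + C_Ψb₀)c_P²)·‖D†z‖` (`D† = LinearMap.adjoint D`;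
`projR Δs Q′ = R(U)` by `projR_QprimeL2_eq_RofU`).  [folklore] composition BY NAME. [cite: Balaban1985BackgroundPropagators, Cor 3.6 p.408, (3.87)–(3.89) p.409, (3.8) p.392, (3.26) p.395] -/
theorem norm_sub_projR_collar_le_adjoint (hm : ∀ i, 1 ≤ m i) (Z₀ : Finset (TSite d m)) {Y₀ : Finset (TSite d m)}
    (hY₀ : Y₀ = Finset.univ.filter fun y => ∃ z₀ ∈ Z₀, tdist m z₀ y ≤ 1) {r₀ R : ℝ} (hr₀ : 0 < r₀) (hR : 0 < R)
    {N : Submodule ℂ (SiteL2K ℂ d (fineP L m) c₀ W)}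
    (hN : ∀ f : SiteL2K ℂ d (fineP L m) c₀ W, f ∈ N ↔
      ∀ x : TSite d (fineP L m), blockCoord L m x ∉ {y : TSite d m | ∃ y₀ ∈ Y₀, tdist m y₀ y < r₀ + R} → WL2.equiv ℂ _ W f x = 0)
    (ha₁ : a₁ = Real.sqrt d * ((L : ℝ) / R * (Mφ * Mφ' + 1))) (ha₀ : a₀ = d * (2 * (L : ℝ) ^ 2 / R))
    (hb₀ : b₀ = (1 + 2 * Mφ * Mφ' * ε) ^ (d * (L - 1)) * (d * ((L : ℝ) / R)))
    (z : BondL2K ℂ d (fineP L m) c₀ W) (hz : ∀ b : Bond d (fineP L m), blockCoord L m (bpos b) ∉ Z₀ → WL2.equiv ℂ _ W z b = 0) :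
    ‖LinearMap.adjoint D z - projR Δs (Q'.prod N.mkQ) (LinearMap.adjoint D z)‖ ≤
      ‖LinearMap.adjoint D z - projR Δs Q' (LinearMap.adjoint D z)‖ +
        (C * latticeConst d (κ / 2) * Real.exp (-(κ / 2 * r₀)) + a₁ * cP + (a₀ + CΨ * b₀) * cP ^ 2) * ‖LinearMap.adjoint D z‖ := by
  -- `D†z` is supported over `Y₀`
  have hw : ∀ x : TSite d (fineP L m), blockCoord L m x ∉ Y₀ →
      WL2.equiv ℂ (fun _ : TSite d (fineP L m) => c₀) W (LinearMap.adjoint D z) x = 0 := fun x hx => by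
    have hfar : ∀ z₀ ∈ Z₀, 1 < tdist m z₀ (blockCoord L m x) := fun z₀ hz₀ => by
      by_contra hle
      exact hx (by rw [hY₀, Finset.mem_filter]; exact ⟨Finset.mem_univ _, z₀, hz₀, le_of_not_gt hle⟩)
    rw [hD]
    exact adjoint_covDerivL2K_apply_eq_zero_of_far L m hm η (adTransportW φ U) (adTransportW φ fun b => (U b)⁻¹) hRS z Z₀ hz x hfar
  -- `R′ = R(U)` at the letters
  have hRR : projR Δs Q' = RofU L m φ η U (c₀ := c₀) := by
    rw [hΔs, hQ']; exact projR_QprimeL2_eq_RofU L m φ (c₁ := c₁) η U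
  rw [hRR]
  exact norm_sub_projR_collar_le L m φ η U hL hLη hc hPS hC hκ hdec hRS hMφ hφ hMφ' hφ' hU1 hε hUε hβ hcol hq ha' hγ hγc Δs hΔs Q' hQ' hcP hCΨ
    Y₀ hr₀ hR hN ha₁ ha₀ hb₀ hm _ hw

end Gamma

end Literature.MathematicalPhysics.QuantumFieldTheory.Balaban1983to89.B9Eq389CubeLocalisedProjectionAdjoint

end
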